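import Summits.HubbardSuperconductivity.HubbardSuperconductivity.Theorems.SeamGluingLocality.Negative.FreeBandMultiplicity

/-!
# `SeamGluingLocality` (stmt-HubbardSuperconductivity-18509), negative side: `0 < U` is load-bearing —
# at zero coupling the exact-degeneracy claim (3) fails on glued square tori, cofinally in the size

The crux `C` asserts, at every `(U, δ)`, eventually in the sizes, for all admissible gluings
`M' + M'' = M`: (1) `(1 - M₂/M)(min stiff' stiff'')₊ ≤ stiff_M`, (2) the same for `icomp`, and
(3) `icomp_M ≤ (1 + M₂/M)(max icomp' icomp'')₊`; (3) forces the glued inverse pair compressibility to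
VANISH whenever both parts have `icomp ≤ 0` (hidden claim (iii), `Negative/HiddenClaims`, Kill 3 of
`Negative/KillMenu`). This file proves, sorry-free and WITHOUT any closed-form Fermi sea, that the twin
of `C` with `U := 0` is FALSE — the disprover's near-miss `not_seamGluingLocalityFromZeroU`
(`Cruxes/SeamGluingLocality/Disproof.lean` §3, rated "weeks of infrastructure" there):

* `tubePairCompressibility_zero_coupling_pos_of_closedShell` — at `U = 0` a CLOSED shell
  (`N/2 = #{ε ≤ μ}`) has `ẽ″ = LM(ν - τ)/2 > 0` (`ν` the next level, `τ` the top of the shell);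
* `exists_closedShell_cell` / `exists_delta_closedShells` — a NESTED-CELL construction of ONE doping
  `δ ∈ (0, 3/10)` such that for cofinally many `L ≡ 0 (mod 4)` the pair number `⌊(1-δ)L²/2⌋` of the
  square torus `L × L` is a closed-shell count below half filling (level multiplicity `≤ 2L`, so every
  run of `2L` consecutive fillings contains a closed shell; the doping cells have width `1/(2L²)`);
* `exists_cofinal_zero_coupling_exactDegeneracyFailure` — at that `δ`, for every threshold pair
  `(M₂, L₂)`: gluing two `L × L/2` tubes (pair number `(n-1)/2`, EVEN because a square closed shell
  below half filling holds `n ≡ 1 (mod 4)` momenta, `card_filter_tubeBand_le_mod_four`; so both parts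
  sit on OPEN shells, `ẽ″ = 0`) into the square torus `L × L` (closed shell, `ẽ″ > 0`) violates (3);
* **`seamGluingLocality_false_at_zero_coupling`** — the crux over the names with `U := 0` is false;
* **`not_seamGluingLocality_fromZeroU`** — verbatim negation of the disprover's
  `SeamGluingLocalityFromZeroU` (`0 ≤ U` admitted); closes that `sorry` by `exact`.

Reading. Like the `ZeroCouplingCompressibility` negatives of 18510 and 16312, this calibrates 18509
along its side condition `0 < U`: any proof of the crux AS TYPED must use the interaction to lift the
free closed-shell/open-shell mismatch between a glued tube and its parts at some doping. The witness
has parts with `icomp' = icomp'' = 0`, so it is EXCLUDED by the guarded restatement `C‴`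
(`0 < min(icomp', icomp'')` as a hypothesis of (2)–(3); evidence `seam18509-verdict.md`,
`RESTATE-GLUE-s7.md` on the item): the repair is necessary and evades this witness. The crux itself
(`0 < U`) is untouched. Folklore (free-electron shell structure; D. J. Scalapino, S. R. White,
S. C. Zhang, PRB 47 (1993) 7995 §II). No definitions, no named facts. REUSED: `tubeEnergy_free_eq`,
`tubePairCompressibility_zero_coupling_eq_zero_of_even`, `neg_four_le_tubeBand`, the counting lemmas of
`SquareShellCounting` / `FreeBandMultiplicity`.
-/

noncomputable section

namespace Summit.HubbardSuperconductivity.HubbardSuperconductivity.Theorems.SeamGluingLocality.Negative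

set_option linter.dupNamespace false -- summit = problem name (single-conjunct summit), D-0017

open scoped BigOperators Classical
open Finset Summit.HubbardSuperconductivity.HubbardSuperconductivity.Theorems.WidthHaldane
open Summit.HubbardSuperconductivity.HubbardSuperconductivity.Theorems.WidthUniformThermodynamics.Negative
open Summit.HubbardSuperconductivity.HubbardSuperconductivity.Theorems.PerWidthThermodynamics.Negative

/-! ### Closed shells have positive free pair compressibility -/

section ClosedShell

variable {L M : ℕ} [NeZero L] [NeZero M] {Λ : Type} [LinearOrder Λ] [Fintype Λ]
  (e : Λ ≃ ZMod L × ZMod M)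

/-- **On a closed shell the free pair compressibility is positive.** For `L, M ≥ 3`, if the pair
number `n = N_{L,M}(δ)/2` is a cumulative shell count `#{ε_{L,M} ≤ μ}` with `0 < n < LM`, then at
`U = 0`: `ẽ″_{L,M}(0, δ) = LM·(ν - τ)/2 > 0`, where `τ ≤ μ` is the top level of the shell and `ν > μ`
the next level — the three Fermi seas `{ε ≤ μ} ∖ {top}`, `{ε ≤ μ}`, `{ε ≤ μ} ∪ {next}` and
`tubeEnergy_free_eq`. Scalapino–White–Zhang (1993) §II. [folklore] -/
theorem tubePairCompressibility_zero_coupling_pos_of_closedShell (hL : 3 ≤ L) (hM : 3 ≤ M) {δ : ℝ}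
    {n : ℕ} (hN : tubeFilling L M δ = 2 * n) {μ : ℝ}
    (hn : (univ.filter fun k : ZMod L × ZMod M => tubeBand L M k ≤ μ).card = n) (hn0 : 0 < n)
    (hnLM : n < L * M) : 0 < tubePairCompressibility L M Λ e 0 δ := by
  set A := univ.filter fun k : ZMod L × ZMod M => tubeBand L M k ≤ μ with hA
  have hAmem : ∀ k, k ∈ A ↔ tubeBand L M k ≤ μ := fun k => by
    rw [hA, mem_filter]; exact ⟨fun h => h.2, fun h => ⟨mem_univ _, h⟩⟩
  have hAne : A.Nonempty := card_pos.1 (by omega)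
  have hAc : Aᶜ.Nonempty := by
    rw [← card_pos, card_compl, Fintype.card_prod, ZMod.card, ZMod.card]; omega
  -- top of the shell, bottom of the next level
  obtain ⟨p, hpA, hpmax⟩ := Finset.mem_image.1 (Finset.max'_mem (A.image (tubeBand L M)) (hAne.image _))
  obtain ⟨q, hqA, hqmin⟩ := Finset.mem_image.1 (Finset.min'_mem (Aᶜ.image (tubeBand L M)) (hAc.image _))
  set τ := (A.image (tubeBand L M)).max' (hAne.image _) with hτ
  set ν := (Aᶜ.image (tubeBand L M)).min' (hAc.image _) with hν
  have hτμ : τ ≤ μ := by rw [← hpmax]; exact (hAmem p).1 hpA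
  have hqA0 : q ∉ A := mem_compl.1 hqA
  have hμν : μ < ν := by rw [← hqmin]; exact lt_of_not_ge fun h => hqA0 ((hAmem q).2 h)
  -- three Fermi seas: `A.erase p ⊂ A ⊂ insert q A`
  have hF : (∀ k ∈ A, tubeBand L M k ≤ μ) ∧ ∀ k ∉ A, μ ≤ tubeBand L M k :=
    ⟨fun k hk => (hAmem k).1 hk, fun k hk => (lt_of_not_ge fun h => hk ((hAmem k).2 h)).le⟩
  have hFp : (∀ k ∈ insert q A, tubeBand L M k ≤ ν) ∧ ∀ k ∉ insert q A, ν ≤ tubeBand L M k := by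
    refine ⟨fun k hk => ?_, fun k hk => ?_⟩
    · rcases mem_insert.1 hk with rfl | hk
      · exact hqmin.le
      · exact ((hAmem k).1 hk).trans hμν.le
    · rw [mem_insert, not_or] at hk
      exact Finset.min'_le _ _ (mem_image_of_mem _ (mem_compl.2 hk.2))
  have hFm : (∀ k ∈ A.erase p, tubeBand L M k ≤ τ) ∧ ∀ k ∉ A.erase p, τ ≤ tubeBand L M k := by
    refine ⟨fun k hk => Finset.le_max' _ _ (mem_image_of_mem _ (mem_of_mem_erase hk)), fun k hk => ?_⟩
    by_cases hkp : k = p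
    · rw [hkp, hpmax]
    · have hkA : k ∉ A := fun h => hk (mem_erase.2 ⟨hkp, h⟩)
      exact hτμ.trans (hF.2 k hkA)
  -- cardinalities
  have hcp : (insert q A).card = n + 1 := by rw [card_insert_of_notMem hqA0, hn]
  have hcm : (A.erase p).card = n - 1 := by rw [card_erase_of_mem hpA, hn]
  -- the three free energies
  have hE : tubeEnergy L M Λ e 0 0 (tubeFilling L M δ) = 2 * ∑ k ∈ A, tubeBand L M k := by
    rw [hN, ← hn]; exact tubeEnergy_free_eq e hL hM A μ hF.1 hF.2
  have hEp : tubeEnergy L M Λ e 0 0 (tubeFilling L M δ + 2) = 2 * ∑ k ∈ insert q A, tubeBand L M k := by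
    have h2 : tubeFilling L M δ + 2 = 2 * (insert q A).card := by rw [hcp, hN]; ring
    rw [h2]; exact tubeEnergy_free_eq e hL hM _ ν hFp.1 hFp.2
  have hEm : tubeEnergy L M Λ e 0 0 (tubeFilling L M δ - 2) = 2 * ∑ k ∈ A.erase p, tubeBand L M k := by
    have h2 : tubeFilling L M δ - 2 = 2 * (A.erase p).card := by rw [hcm, hN]; omega
    rw [h2]; exact tubeEnergy_free_eq e hL hM _ τ hFm.1 hFm.2
  have hsp : ∑ k ∈ insert q A, tubeBand L M k = tubeBand L M q + ∑ k ∈ A, tubeBand L M k :=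
    sum_insert hqA0
  have hsm : ∑ k ∈ A, tubeBand L M k = tubeBand L M p + ∑ k ∈ A.erase p, tubeBand L M k :=
    (add_sum_erase A (tubeBand L M) hpA).symm
  have h1 : (0 : ℝ) < L := by exact_mod_cast (by omega : 0 < L)
  have h2 : (0 : ℝ) < M := by exact_mod_cast (by omega : 0 < M)
  have hLM : (0 : ℝ) < (L : ℝ) * (M : ℝ) := by positivity
  rw [tubePairCompressibility, hEp, hEm, hE, hsp, hsm, hqmin, hpmax]
  have hντ : 0 < ν - τ := by linarith
  nlinarith [mul_pos hLM hντ]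

end ClosedShell

/-! ### One closed-shell doping cell inside every doping window, cofinally in `L` -/

section Cell

/-- **A closed-shell cell.** Inside every doping window `(α, β) ⊂ (0, 3/10)` and beyond every length
threshold `L₀` there are `L ≡ 0 (mod 4)`, `L ≥ 8`, a closed cell `[lo, hi] ⊂ (α, β)` and a closed shell
`n = #{ε_{L,L} ≤ μ}` of the free square torus below half filling (`-4 ≤ μ < 0`) such that every doping
`δ ∈ [lo, hi]` has `(1-δ)L²/2 ∈ [n + 1/4, n + 3/4]` (so the pair number of the `L × L` torus is `n`
and that of the `L × L/2` tube is `⌊n/2 + ·⌋`): as `δ` sweeps `(α, β)` the target `(1-δ)L²/2` sweeps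
more than `2L + 2` integers below `#{ε < 0} ≥ L²/2 - L`, and a closed-shell count occurs in every run
of `2L` of them (`exists_closedShell_le`, multiplicity `≤ 2L`). [folklore] -/
theorem exists_closedShell_cell {α β : ℝ} (hα : 0 < α) (hαβ : α < β) (hβ : β < 3 / 10) (L₀ : ℕ) :
    ∃ (L : ℕ) (_ : NeZero L), L₀ ≤ L ∧ 4 ∣ L ∧ 8 ≤ L ∧ ∃ lo hi : ℝ, α < lo ∧ lo < hi ∧ hi < β ∧
      ∃ (n : ℕ) (μ : ℝ), μ < 0 ∧ -4 ≤ μ ∧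
        (univ.filter fun k : ZMod L × ZMod L => tubeBand L L k ≤ μ).card = n ∧
        ∀ δ ∈ Set.Icc lo hi, (n : ℝ) + 1 / 4 ≤ (1 - δ) * ((L : ℝ) * (L : ℝ)) / 2 ∧
          (1 - δ) * ((L : ℝ) * (L : ℝ)) / 2 ≤ n + 3 / 4 := by
  obtain ⟨K₁, hK₁⟩ := exists_nat_gt (8 / (β - α))
  obtain ⟨K₂, hK₂⟩ := exists_nat_gt (4 / α)
  obtain ⟨L, hLdef⟩ : ∃ L : ℕ, L = 4 * (L₀ + K₁ + K₂ + 2) := ⟨_, rfl⟩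
  haveI iL : NeZero L := ⟨by omega⟩
  have hLe : Even L := ⟨2 * (L₀ + K₁ + K₂ + 2), by omega⟩
  have hL8 : 8 ≤ L := by omega
  have hLpos : (0 : ℝ) < L := by exact_mod_cast (by omega : 0 < L)
  have hLR : (K₁ : ℝ) ≤ L ∧ (K₂ : ℝ) ≤ L := ⟨by exact_mod_cast (by omega : K₁ ≤ L), by exact_mod_cast (by omega : K₂ ≤ L)⟩
  have hβα : 0 < β - α := sub_pos.2 hαβ
  -- `(β - α) L ≥ 8` and `α L ≥ 4`
  have h8 : 8 ≤ (β - α) * L := by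
    have hK : 8 / (β - α) < L := hK₁.trans_le hLR.1
    have := (div_lt_iff₀ hβα).1 hK
    linarith
  have h4 : 4 ≤ α * L := by
    have hK : 4 / α < L := hK₂.trans_le hLR.2
    have := (div_lt_iff₀ hα).1 hK
    linarith
  have hroom : 4 * (L : ℝ) ≤ (β - α) * ((L : ℝ) * L) / 2 := by nlinarith
  have hαL : 2 * (L : ℝ) ≤ α * ((L : ℝ) * L) / 2 := by nlinarith
  -- the negative levels: `2 #{ε < 0} + 2L ≥ L²`
  set Neg := univ.filter fun k : ZMod L × ZMod L => tubeBand L L k < 0 with hNeg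
  have hneg : L * L ≤ 2 * Neg.card + 2 * L := le_card_filter_tubeBand_neg (L := L) (M := L) hLe hLe
  have hnegR : (L : ℝ) * L ≤ 2 * (Neg.card : ℝ) + 2 * L := by exact_mod_cast hneg
  -- the largest negative level `vneg`; its closed shell is `{ε < 0}`
  have h00 : ((0 : ZMod L), (0 : ZMod L)) ∈ Neg := by
    rw [hNeg, mem_filter, tubeBand_zero_zero]; exact ⟨mem_univ _, by norm_num⟩
  have hNegne : Neg.Nonempty := ⟨_, h00⟩
  obtain ⟨k₀, hk₀, hk₀v⟩ := Finset.mem_image.1 (Finset.max'_mem (Neg.image (tubeBand L L)) (hNegne.image _))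
  set vneg := (Neg.image (tubeBand L L)).max' (hNegne.image _) with hvneg
  have hvneg0 : vneg < 0 := by
    rw [← hk₀v]; rw [hNeg] at hk₀; exact (mem_filter.1 hk₀).2
  have hCv : (univ.filter fun k : ZMod L × ZMod L => tubeBand L L k ≤ vneg) = Neg := by
    ext k
    rw [hNeg, mem_filter, mem_filter]
    exact ⟨fun h => ⟨h.1, h.2.trans_lt hvneg0⟩,
      fun h => ⟨h.1, Finset.le_max' _ _ (mem_image_of_mem _ (by rw [hNeg]; exact mem_filter.2 h))⟩⟩
  -- the target count
  have h1β' : 0 ≤ 1 - β := by linarith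
  have h1β : (0 : ℝ) ≤ (1 - β) * ((L : ℝ) * L) / 2 := by positivity
  obtain ⟨t, ht⟩ : ∃ t : ℕ, t = ⌊(1 - β) * ((L : ℝ) * L) / 2⌋₊ + 1 := ⟨_, rfl⟩
  have ht0 : 0 < t := by omega
  have htlo : (1 - β) * ((L : ℝ) * L) / 2 < t := by
    rw [ht]; push_cast; exact Nat.lt_floor_add_one _
  have hthi : (t : ℝ) ≤ (1 - β) * ((L : ℝ) * L) / 2 + 1 := by
    rw [ht]; push_cast; linarith [Nat.floor_le h1β]
  have htNeg : t ≤ Neg.card := by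
    have hR : (t : ℝ) ≤ (Neg.card : ℝ) := by nlinarith
    exact_mod_cast hR
  obtain ⟨μ, hμle, htμ, hμt⟩ := exists_closedShell_le (tubeBand L L) (m := 2 * L)
    (card_filter_tubeBand_eq_le (L := L) (M := L)) ht0 (v₀ := vneg) (by rw [hCv]; exact htNeg)
  set n := (univ.filter fun k : ZMod L × ZMod L => tubeBand L L k ≤ μ).card with hn
  have hμ0 : μ < 0 := hμle.trans_lt hvneg0
  have hμ4 : -4 ≤ μ := by
    by_contra h
    rw [not_le] at h
    have h0 : (univ.filter fun k : ZMod L × ZMod L => tubeBand L L k ≤ μ) = ∅ :=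
      Finset.filter_false_of_mem fun k _ => by
        have := neg_four_le_tubeBand (L := L) (M := L) k; linarith
    have : n = 0 := by rw [hn, h0, card_empty]
    omega
  have hnR : (t : ℝ) ≤ n ∧ (n : ℝ) < t + 2 * L := ⟨by exact_mod_cast htμ, by exact_mod_cast hμt⟩
  have hL2 : (0 : ℝ) < (L : ℝ) * L := by positivity
  refine ⟨L, iL, by omega, ⟨L₀ + K₁ + K₂ + 2, hLdef⟩, hL8,
    1 - 2 * ((n : ℝ) + 3 / 4) / ((L : ℝ) * L), 1 - 2 * ((n : ℝ) + 1 / 4) / ((L : ℝ) * L),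
    ?_, ?_, ?_, n, μ, hμ0, hμ4, rfl, ?_⟩
  · -- `α < lo`
    have : 2 * ((n : ℝ) + 3 / 4) / ((L : ℝ) * L) < 1 - α := by
      rw [div_lt_iff₀ hL2]; nlinarith
    linarith
  · -- `lo < hi`
    have : 2 * ((n : ℝ) + 1 / 4) / ((L : ℝ) * L) < 2 * ((n : ℝ) + 3 / 4) / ((L : ℝ) * L) := by
      apply div_lt_div_of_pos_right _ hL2; linarith
    linarith
  · -- `hi < β`
    have : 1 - β < 2 * ((n : ℝ) + 1 / 4) / ((L : ℝ) * L) := by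
      rw [lt_div_iff₀ hL2]; nlinarith
    linarith
  · rintro δ ⟨hlo, hhi⟩
    constructor
    · have h1 : 2 * ((n : ℝ) + 1 / 4) / ((L : ℝ) * L) ≤ 1 - δ := by linarith
      rw [div_le_iff₀ hL2] at h1
      linarith
    · have h1 : 1 - δ ≤ 2 * ((n : ℝ) + 3 / 4) / ((L : ℝ) * L) := by linarith
      rw [le_div_iff₀ hL2] at h1
      linarith

/-- **One doping, cofinally many closed square shells.** There is ONE `δ ∈ (0, 3/10)` such that for
every `L₀` some `L ≥ L₀` with `4 ∣ L`, `L ≥ 8` has `(1-δ)L²/2 ∈ [n + 1/4, n + 3/4]` for a closed-shell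
count `n = #{ε_{L,L} ≤ μ}`, `-4 ≤ μ < 0` — by NESTED CELLS: iterate `exists_closedShell_cell` with
thresholds `L₀ = 0, 1, 2, …`, each cell strictly inside the previous one, and take `δ = sup` of the left
end points. (A measure/equidistribution statement "every `δ`" is not claimed.) [folklore] -/
theorem exists_delta_closedShells :
    ∃ δ ∈ Set.Ioo (0 : ℝ) (3 / 10), ∀ L₀ : ℕ, ∃ (L : ℕ) (_ : NeZero L), L₀ ≤ L ∧ 4 ∣ L ∧ 8 ≤ L ∧
      ∃ (n : ℕ) (μ : ℝ), μ < 0 ∧ -4 ≤ μ ∧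
        (univ.filter fun k : ZMod L × ZMod L => tubeBand L L k ≤ μ).card = n ∧
        (n : ℝ) + 1 / 4 ≤ (1 - δ) * ((L : ℝ) * (L : ℝ)) / 2 ∧
          (1 - δ) * ((L : ℝ) * (L : ℝ)) / 2 ≤ n + 3 / 4 := by
  -- one step of the nesting
  have step : ∀ (p : {p : ℝ × ℝ // 0 < p.1 ∧ p.1 < p.2 ∧ p.2 < 3 / 10}) (j : ℕ),
      ∃ q : {p : ℝ × ℝ // 0 < p.1 ∧ p.1 < p.2 ∧ p.2 < 3 / 10}, p.1.1 < q.1.1 ∧ q.1.2 < p.1.2 ∧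
        ∃ (L : ℕ) (_ : NeZero L), j ≤ L ∧ 4 ∣ L ∧ 8 ≤ L ∧ ∃ (n : ℕ) (μ : ℝ), μ < 0 ∧ -4 ≤ μ ∧
          (univ.filter fun k : ZMod L × ZMod L => tubeBand L L k ≤ μ).card = n ∧
          ∀ δ ∈ Set.Icc q.1.1 q.1.2, (n : ℝ) + 1 / 4 ≤ (1 - δ) * ((L : ℝ) * (L : ℝ)) / 2 ∧
            (1 - δ) * ((L : ℝ) * (L : ℝ)) / 2 ≤ n + 3 / 4 := by
    intro p j
    obtain ⟨L, iL, hjL, h4, h8, lo, hi, hlo, hlohi, hhi, n, μ, hμ, hμ', hcard, hcell⟩ :=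
      exists_closedShell_cell p.2.1 p.2.2.1 p.2.2.2 j
    exact ⟨⟨(lo, hi), p.2.1.trans hlo, hlohi, hhi.trans p.2.2.2⟩, hlo, hhi, L, iL, hjL, h4, h8, n, μ, hμ,
      hμ', hcard, hcell⟩
  choose next hlo hhi hnext using step
  -- the nested sequence of windows, starting from `(1/10, 1/5)`
  set s : ℕ → {p : ℝ × ℝ // 0 < p.1 ∧ p.1 < p.2 ∧ p.2 < 3 / 10} := fun k =>
    @Nat.rec (fun _ => {p : ℝ × ℝ // 0 < p.1 ∧ p.1 < p.2 ∧ p.2 < 3 / 10})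
      ⟨((1 : ℝ) / 10, (1 : ℝ) / 5), by norm_num⟩ (fun j q => next q j) k with hs
  have hsucc : ∀ k, s (k + 1) = next (s k) k := fun k => rfl
  have hmono : StrictMono fun k => (s k).1.1 :=
    strictMono_nat_of_lt_succ fun k => by
      show (s k).1.1 < (s (k + 1)).1.1
      rw [hsucc]; exact hlo _ _
  have hanti : StrictAnti fun k => (s k).1.2 :=
    strictAnti_nat_of_succ_lt fun k => by
      show (s (k + 1)).1.2 < (s k).1.2
      rw [hsucc]; exact hhi _ _
  have hlohi : ∀ j k, (s j).1.1 < (s k).1.2 := fun j k => by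
    rcases le_total j k with h | h
    · exact (hmono.monotone h).trans_lt (s k).2.2.1
    · exact (s j).2.2.1.trans_le (hanti.antitone h)
  have hbdd : BddAbove (Set.range fun k => (s k).1.1) := ⟨(s 0).1.2, by rintro _ ⟨k, rfl⟩; exact (hlohi k 0).le⟩
  obtain ⟨δ, hδ⟩ : ∃ δ : ℝ, δ = ⨆ k, (s k).1.1 := ⟨_, rfl⟩
  have hloδ : ∀ k, (s k).1.1 ≤ δ := fun k => by rw [hδ]; exact le_ciSup hbdd k
  have hδhi : ∀ k, δ ≤ (s k).1.2 := fun k => by rw [hδ]; exact ciSup_le fun j => (hlohi j k).le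
  refine ⟨δ, ⟨(s 0).2.1.trans_le (hloδ 0), (hδhi 0).trans_lt (s 0).2.2.2⟩, fun L₀ => ?_⟩
  obtain ⟨L, iL, hL₀, h4, h8, n, μ, hμ, hμ', hcard, hcell⟩ := hnext (s L₀) L₀
  have hδcell : δ ∈ Set.Icc (next (s L₀) L₀).1.1 (next (s L₀) L₀).1.2 :=
    ⟨by rw [← hsucc]; exact hloδ (L₀ + 1), by rw [← hsucc]; exact hδhi (L₀ + 1)⟩
  exact ⟨L, iL, hL₀, h4, h8, n, μ, hμ, hμ', hcard, hcell δ hδcell⟩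

end Cell

/-! ### `0 < U` is load-bearing in `SeamGluingLocality` -/

section Headline

/-- **Kill 3 is realised at zero coupling.** There is a doping `δ ∈ (0, 3/10)` at which, for EVERY
threshold pair `(M₂, L₂)`, some admissible equal-width gluing beyond the thresholds — two `L × L/2`
tubes (`L ≡ 0 (mod 4)`, any carrier; here `Fin`) into the square torus `L × L` — has, at `U = 0`,
parts on OPEN shells (`ẽ″ = 0`: their pair number `⌊(1-δ)L²/4⌋ = (n-1)/2` is even since the glued
closed shell holds `n ≡ 1 (mod 4)` momenta) and the glued tube on a CLOSED shell (`ẽ″ > 0`).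
[folklore] -/
theorem exists_cofinal_zero_coupling_exactDegeneracyFailure :
    ∃ δ ∈ Set.Ioo (0 : ℝ) (3 / 10), ∀ M₂ L₂ : ℕ, ∃ (L : ℕ) (_ : NeZero L) (_ : NeZero (L / 2)),
      Even L ∧ Even (L / 2) ∧ M₂ ≤ L / 2 ∧ L / 2 + L / 2 = L ∧ L₂ ≤ L ∧
      tubePairCompressibility L (L / 2) (Fin (L * (L / 2)))
          (finProdFinEquiv.symm.trans
            (Equiv.prodCongr (ZMod.finEquiv L).toEquiv (ZMod.finEquiv (L / 2)).toEquiv)) 0 δ = 0 ∧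
      0 < tubePairCompressibility L L (Fin (L * L))
          (finProdFinEquiv.symm.trans
            (Equiv.prodCongr (ZMod.finEquiv L).toEquiv (ZMod.finEquiv L).toEquiv)) 0 δ := by
  obtain ⟨δ, hδ, hfam⟩ := exists_delta_closedShells
  refine ⟨δ, hδ, fun M₂ L₂ => ?_⟩
  obtain ⟨L, iL, hL₀, ⟨j, hj⟩, h8, n, μ, hμ0, hμ4, hcard, hlo, hhi⟩ := hfam (L₂ + 2 * M₂ + 8)
  have hLe : Even L := ⟨2 * j, by omega⟩
  have hMe : Even (L / 2) := ⟨j, by omega⟩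
  haveI iM : NeZero (L / 2) := ⟨by omega⟩
  have hmod : n % 4 = 1 := by rw [← hcard]; exact card_filter_tubeBand_le_mod_four hLe hμ0 hμ4
  obtain ⟨q, hq⟩ : ∃ q, n = 4 * q + 1 := ⟨n / 4, by omega⟩
  have hL8 : (8 : ℝ) ≤ L := by exact_mod_cast h8
  have hnq : (n : ℝ) = 4 * q + 1 := by exact_mod_cast hq
  have h1δ : 0 < 1 - δ := by linarith [hδ.2]
  have hL2 : (0 : ℝ) < (L : ℝ) * L := by positivity
  have hnn : (0 : ℝ) ≤ (1 - δ) * ((L : ℝ) * L) / 2 := by positivity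
  -- glued filling `2n`
  have hfillL : tubeFilling L L δ = 2 * n := by
    rw [tubeFilling]
    congr 1
    rw [Nat.floor_eq_iff hnn]
    constructor <;> linarith
  -- parts filling `2 · 2q`
  have hcast : ((L / 2 : ℕ) : ℝ) = (L : ℝ) / 2 := by
    have h2 : (((L / 2) * 2 : ℕ) : ℝ) = L := by rw [Nat.div_two_mul_two_of_even hLe]
    push_cast at h2
    linarith
  have hnn' : (0 : ℝ) ≤ (1 - δ) * ((L : ℝ) * ((L / 2 : ℕ) : ℝ)) / 2 := by positivity
  have hfillM : tubeFilling L (L / 2) δ = 2 * (2 * q) := by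
    rw [tubeFilling]
    congr 1
    rw [Nat.floor_eq_iff hnn', hcast]
    push_cast
    constructor <;> nlinarith
  -- sizes
  have h64 : (64 : ℝ) ≤ (L : ℝ) * L := by nlinarith
  have h07 : (7 / 10 : ℝ) * ((L : ℝ) * L) ≤ (1 - δ) * ((L : ℝ) * L) :=
    mul_le_mul_of_nonneg_right (by linarith [hδ.2]) hL2.le
  have hn4 : (4 : ℝ) < n := by linarith
  have hn5 : 5 ≤ n := by exact_mod_cast hn4
  have h2n : 2 * n < L * L := by
    have h' : 2 * (n : ℝ) < (L : ℝ) * L := by nlinarith [hδ.1]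
    exact_mod_cast h'
  have hLL : 2 * (L * (L / 2)) = L * L := by
    rw [Nat.mul_left_comm, Nat.two_mul_div_two_of_even hLe]
  refine ⟨L, iL, iM, hLe, hMe, by omega, by omega, by omega, ?_, ?_⟩
  · exact tubePairCompressibility_zero_coupling_eq_zero_of_even _ hLe hMe (by omega) (by omega) hfillM
      (even_two_mul q) (by omega) (by omega)
  · exact tubePairCompressibility_zero_coupling_pos_of_closedShell _ (by omega) (by omega) hfillL hcard
      (by omega) (by omega)

/-- **`0 < U` is load-bearing in `SeamGluingLocality` (stmt-HubbardSuperconductivity-18509).** The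
crux over the names (`WidthHaldaneDefs.seamGluingLocality_iff`) with `U := 0` is FALSE: at the doping
of `exists_cofinal_zero_coupling_exactDegeneracyFailure`, whatever the thresholds `(M₂, L₂)`, gluing two
free `L × L/2` tubes on open shells (`ẽ″ = 0`) into the free square torus `L × L` on a closed shell
(`ẽ″ > 0`) violates inequality (3), `ẽ″_M ≤ (1 + M₂/M)·(max ẽ″' ẽ″'')₊ = 0`. Reading: the
exact-degeneracy content of the crux is an INTERACTION claim; any proof of the crux as typed must use
`0 < U` to split the free shell structure at least at one doping; the guarded restatement (parts
required to be compressible, `0 < min ẽ″' ẽ″''`) is not hit by this witness. The crux itself is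
untouched. [folklore] -/
theorem seamGluingLocality_false_at_zero_coupling :
    ¬ ∀ δ ∈ Set.Ioo (0 : ℝ) (3 / 10), ∃ M₂ L₂ : ℕ,
        ∀ (L M' M'' M : ℕ) [NeZero L] [NeZero M'] [NeZero M''] [NeZero M], Even L → Even M' →
          Even M'' → M₂ ≤ M' → M₂ ≤ M'' → M' + M'' = M → M ≤ L → L₂ ≤ L →
            ∀ (Λ' : Type) [LinearOrder Λ'] [Fintype Λ'] (e' : Λ' ≃ ZMod L × ZMod M')
              (Λ'' : Type) [LinearOrder Λ''] [Fintype Λ''] (e'' : Λ'' ≃ ZMod L × ZMod M'')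
              (Λ : Type) [LinearOrder Λ] [Fintype Λ] (e : Λ ≃ ZMod L × ZMod M),
              (1 - (M₂ : ℝ) / M) * max (min (tubeStiffness L M' Λ' e' 0 δ) (tubeStiffness L M'' Λ'' e'' 0 δ)) 0 ≤
                  tubeStiffness L M Λ e 0 δ ∧
                (1 - (M₂ : ℝ) / M) *
                    max (min (tubePairCompressibility L M' Λ' e' 0 δ)
                      (tubePairCompressibility L M'' Λ'' e'' 0 δ)) 0 ≤
                  tubePairCompressibility L M Λ e 0 δ ∧
                tubePairCompressibility L M Λ e 0 δ ≤
                  (1 + (M₂ : ℝ) / M) *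
                    max (max (tubePairCompressibility L M' Λ' e' 0 δ)
                      (tubePairCompressibility L M'' Λ'' e'' 0 δ)) 0 := by
  intro h
  obtain ⟨δ, hδ, hfam⟩ := exists_cofinal_zero_coupling_exactDegeneracyFailure
  obtain ⟨M₂, L₂, hC⟩ := h δ hδ
  obtain ⟨L, iL, iM, hLe, hMe, hM₂, hsum, hL₂, hzero, hpos⟩ := hfam M₂ L₂
  obtain ⟨-, -, h3⟩ := hC L (L / 2) (L / 2) L hLe hMe hMe hM₂ hM₂ hsum le_rfl hL₂ (Fin (L * (L / 2)))
    (finProdFinEquiv.symm.trans (Equiv.prodCongr (ZMod.finEquiv L).toEquiv (ZMod.finEquiv (L / 2)).toEquiv))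
    (Fin (L * (L / 2))) (finProdFinEquiv.symm.trans
      (Equiv.prodCongr (ZMod.finEquiv L).toEquiv (ZMod.finEquiv (L / 2)).toEquiv)) (Fin (L * L))
    (finProdFinEquiv.symm.trans (Equiv.prodCongr (ZMod.finEquiv L).toEquiv (ZMod.finEquiv L).toEquiv))
  rw [hzero, max_self, max_self, mul_zero] at h3
  linarith

/-- **The disprover's near-miss, closed.** Verbatim negation of `SeamGluingLocalityFromZeroU` of
`Cruxes/SeamGluingLocality/Disproof.lean` §3 (the crux with `0 ≤ U` in place of `0 < U`, stated over the
crux's own `let`-prefix): it is FALSE, by `seamGluingLocality_false_at_zero_coupling` at `U = 0` (the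
`let`-bound functionals are definitionally `tubeStiffness` / `tubePairCompressibility`,
`WidthHaldaneDefs.seamGluingLocality_iff`). [folklore] -/
theorem not_seamGluingLocality_fromZeroU :
    ¬ (open Matrix Literature.MathematicalPhysics.QuantumLattice in let H0 : ∀ (L M : ℕ) (Λ : Type) [LinearOrder Λ] [Fintype Λ], (Λ ≃ ZMod L × ZMod M) → ℝ → Matrix (Finset (Orb Λ)) (Finset (Orb Λ)) ℂ := fun _ _ Λ _ _ e U => hamiltonian (SimpleGraph.fromRel fun x y : Λ => y = e.symm ((e x).1 + 1, (e x).2) ∨ y = e.symm ((e x).1, (e x).2 + 1)) 1 U; let Tw : ∀ (L M : ℕ) [NeZero L] [NeZero M] (Λ : Type) [LinearOrder Λ] [Fintype Λ], (Λ ≃ ZMod L × ZMod M) → ℝ → Matrix (Finset (Orb Λ)) (Finset (Orb Λ)) ℂ := fun _ M _ _ _ _ _ e θ => ∑ b : ZMod M, ∑ σ : Fin 2, ((1 - Complex.exp (Complex.I * θ)) • (creation (orb (e.symm (0, b)) σ) * annihilation (orb (e.symm (-1, b)) σ)) + (1 - Complex.exp (-(Complex.I * θ))) • (creation (orb (e.symm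 (-1, b)) σ) * annihilation (orb (e.symm (0, b)) σ))); let E : ∀ (L M : ℕ) [NeZero L] [NeZero M] (Λ : Type) [LinearOrder Λ] [Fintype Λ], (Λ ≃ ZMod L × ZMod M) → ℝ → ℝ → ℕ → ℝ := fun L M _ _ Λ _ _ e U θ N => (H0 L M Λ e U + Tw L M Λ e θ).minEnergyOn (szSector N 0); let Np : ℕ → ℕ → ℝ → ℕ := fun L M δ => 2 * ⌊(1 - δ) * ((L : ℝ) * (M : ℝ)) / 2⌋₊; let stiff : ∀ (L M : ℕ) [NeZero L] [NeZero M] (Λ : Type) [LinearOrder Λ] [Fintype Λ], (Λ ≃ ZMod L × ZMod M) → ℝ → ℝ → ℝ := fun L M _ _ Λ _ _ e U δ => 2 * (L : ℝ) * (E L M Λ e U (Real.pi / 3) (Np L M δ) - E L M Λ e U 0 (Np L M δ)) / ((Real.pi / 3) ^ 2 * (M : ℝ)); let icomp : ∀ (L M : ℕ) [NeZero L] [NeZero M] (Λ : Type) [LinearOrder Λ] [Fintype Λ], (Λ ≃ ZMod L × ZMod M) → ℝ → ℝ → ℝ := fun L M _ _ Λ _ _ e U δ => (L : ℝ) * (M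 : ℝ) * (E L M Λ e U 0 (Np L M δ + 2) + E L M Λ e U 0 (Np L M δ - 2) - 2 * E L M Λ e U 0 (Np L M δ)) / 4; ∀ U : ℝ, 0 ≤ U → ∀ δ ∈ Set.Ioo (0 : ℝ) (3 / 10), ∃ M₂ L₂ : ℕ, ∀ (L M' M'' M : ℕ) [NeZero L] [NeZero M'] [NeZero M''] [NeZero M], Even L → Even M' → Even M'' → M₂ ≤ M' → M₂ ≤ M'' → M' + M'' = M → M ≤ L → L₂ ≤ L → ∀ (Λ' : Type) [LinearOrder Λ'] [Fintype Λ'] (e' : Λ' ≃ ZMod L × ZMod M') (Λ'' : Type) [LinearOrder Λ''] [Fintype Λ''] (e'' : Λ'' ≃ ZMod L × ZMod M'') (Λ : Type) [LinearOrder Λ] [Fintype Λ] (e : Λ ≃ ZMod L × ZMod M), (1 - (M₂ : ℝ) / M) * max (min (stiff L M' Λ' e' U δ) (stiff L M'' Λ'' e'' U δ)) 0 ≤ stiff L M Λ e U δ ∧ (1 - (M₂ : ℝ) / M) * max (min (icomp L M' Λ' e' U δ) (icomp L M'' Λ'' e'' U δ)) 0 ≤ icomp L M Λ e U δ ∧ icomp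 L M Λ e U δ ≤ (1 + (M₂ : ℝ) / M) * max (max (icomp L M' Λ' e' U δ) (icomp L M'' Λ'' e'' U δ)) 0) := by
  intro h
  exact seamGluingLocality_false_at_zero_coupling fun δ hδ => h 0 le_rfl δ hδ

end Headline

end Summit.HubbardSuperconductivity.HubbardSuperconductivity.Theorems.SeamGluingLocality.Negative

end
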